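import Mathlib
import Summits.Ventures.HodgeRepro2.Tier7.Line3.TwoVectorPeriod

/-!
# Tier7/Line3/TwoVectorSpectralSum — the spectral side of `R(f)` over finitely many copies (seat t7-L1-p4, gen 3)

LINE 3 (t7-plan-3), version (ii), memo v15 §2g′ (1) (STATUS l. 15352): «on each copy of `π⁰_v`, `R(f_v) φ = ⟨φ, u_B⟩ u_A`
(rank one) and `R(f_v) = 0` on every `σ ≇ π⁰_v`; so `R(f)` is of FINITE RANK on the level-`K_f` forms, … and the
archimedean factor of the spectral side per copy is `P_A(u_A) · conj P_B(u_B)`». `TwoVectorPeriod` p680609 types the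
per-copy statement; THIS FILE sums it over the copies, in the abstract (Mathlib only beyond p680609):

* **the double period is linear in the operator** (`doublePeriod_add`, `doublePeriod_smul`, `doublePeriod_sum`);
* **the spectral side over the copies**: for finitely many pairs `(u_B^l, u_A^l)`,
  `doublePeriod (∑ l, rankOne (u_B^l) (u_A^l)) P Q = ∑ l, P (u_A^l) · conj (Q (u_B^l))` (`doublePeriod_sum_rankOne`; the
  same as the orthonormal-basis sum `∑ i, P (T e_i) · conj (Q e_i)`, `sum_apply_sum_rankOne`), and if it is non-zero
  SOME copy has BOTH periods non-zero (`exists_both_ne_zero_of_ne_zero`); the spectral term of the copy `l` is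
  `spec P Q uB uA l := P (u_A^l) · conj (Q (u_B^l))`, which vanishes when either period does (`spec_zero_A`, `spec_zero_B`
  — the two vanishing clauses of the `DominantSide` spec field, here consequences of the formula);
* **`R(f)` IS the sum of the rank-one maps** (`eq_sum_rankOne_of_copies`): a bounded `T` on an inner product space,
  a finite family of pairwise ORTHOGONAL subspaces `W l` with `⨆ l, W l = ⊤` (the copies), `u_B^l ∈ W l`, and
  `T x = ⟪u_B^l, x⟫ • u_A^l` for `x ∈ W l` — then `T = ∑ l, rankOne (u_B^l) (u_A^l)`, hence
  `doublePeriod T P Q = ∑ l, P (u_A^l) · conj (Q (u_B^l))` (`doublePeriod_eq_sum_of_copies`) and the range of `T` lies in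
  the span of the `u_A^l` (`range_sum_rankOne_le_span`: finite rank);
* **the rest of the space as one more label** (append, crit-2 l. 15390 record (a)): with `T = 0` on the orthogonal
  complement of the (closed) sum `K = ⨆ l, W l` of finitely many orthogonal copies — every other constituent is killed —
  the same conclusions hold without `⨆ l, W l = ⊤` (`eq_sum_rankOne_of_copies_of_zero_orthogonal`,
  `doublePeriod_eq_sum_of_copies_of_zero_orthogonal`, `exists_both_ne_zero_of_copies_of_zero_orthogonal`; the copies may be
  infinite-dimensional, only `K` needs an orthogonal projection).

What stays in words: that the level-`K_f` forms of the fixed archimedean type decompose into finitely many copies of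
the `π⁰_v` (printed: GH 18.2.2 / DE 9.2.2, Howe duality) and that `R(f_v)` acts on each copy as the rank-one map
(Schur at `ι₁` = `TwoVectorPeriod.twoVectorOp_eq`; INPUT G at `ι₂`, `ι₃`, printed). Nothing here is about an adelic
group, a period of an automorphic form, or (N); no device. No sorry; axioms ⊆ {propext, Classical.choice, Quot.sound}.
-/

namespace Summit.Ventures.HodgeRepro2.Tier7.Line3.TwoVectorSpectralSum

open scoped InnerProductSpace
open Summit.Ventures.HodgeRepro2.Tier7.Line3

variable {V : Type*} [NormedAddCommGroup V] [InnerProductSpace ℂ V] [CompleteSpace V]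

section Linearity

/-- the double period is additive in the operator. -/
theorem doublePeriod_add (S T : V →L[ℂ] V) (P Q : V →L[ℂ] ℂ) :
    TwoVectorPeriod.doublePeriod (S + T) P Q =
      TwoVectorPeriod.doublePeriod S P Q + TwoVectorPeriod.doublePeriod T P Q := by
  unfold TwoVectorPeriod.doublePeriod
  rw [add_apply, map_add]

/-- the double period is homogeneous in the operator. -/
theorem doublePeriod_smul (c : ℂ) (T : V →L[ℂ] V) (P Q : V →L[ℂ] ℂ) :
    TwoVectorPeriod.doublePeriod (c • T) P Q = c * TwoVectorPeriod.doublePeriod T P Q := by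
  unfold TwoVectorPeriod.doublePeriod
  rw [smul_apply, map_smul, smul_eq_mul]

/-- the double period of the zero operator is `0`. -/
theorem doublePeriod_zero (P Q : V →L[ℂ] ℂ) : TwoVectorPeriod.doublePeriod (0 : V →L[ℂ] V) P Q = 0 := by
  unfold TwoVectorPeriod.doublePeriod
  rw [zero_apply, map_zero]

/-- **the double period of a finite sum of operators is the sum of the double periods**. -/
theorem doublePeriod_sum {L : Type*} (s : Finset L) (T : L → V →L[ℂ] V) (P Q : V →L[ℂ] ℂ) :
    TwoVectorPeriod.doublePeriod (∑ l ∈ s, T l) P Q = ∑ l ∈ s, TwoVectorPeriod.doublePeriod (T l) P Q := by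
  unfold TwoVectorPeriod.doublePeriod
  rw [sum_apply, map_sum]

end Linearity

section Copies

/-- **the spectral side over the copies**: `doublePeriod (∑ l, rankOne (uB l) (uA l)) P Q = ∑ l, P (uA l) · conj (Q (uB l))`
— each copy contributes its A-period on `u_A^l` times the conjugate B-period on `u_B^l`. -/
theorem doublePeriod_sum_rankOne {L : Type*} (s : Finset L) (uB uA : L → V) (P Q : V →L[ℂ] ℂ) :
    TwoVectorPeriod.doublePeriod (∑ l ∈ s, SchurProjector.rankOne (uB l) (uA l)) P Q =
      ∑ l ∈ s, P (uA l) * (starRingEnd ℂ) (Q (uB l)) := by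
  rw [doublePeriod_sum]
  exact Finset.sum_congr rfl fun l _ => TwoVectorPeriod.doublePeriod_rankOne (uB l) (uA l) P Q

/-- the same as the orthonormal-basis sum: `∑ i, P (T (e i)) · conj (Q (e i)) = ∑ l, P (uA l) · conj (Q (uB l))` for
`T = ∑ l, rankOne (uB l) (uA l)` and every orthonormal basis `e` of the carrier. -/
theorem sum_apply_sum_rankOne {ι L : Type*} [Fintype ι] (e : OrthonormalBasis ι ℂ V) (s : Finset L)
    (uB uA : L → V) (P Q : V →L[ℂ] ℂ) :
    ∑ i, P ((∑ l ∈ s, SchurProjector.rankOne (uB l) (uA l)) (e i)) * (starRingEnd ℂ) (Q (e i)) =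
      ∑ l ∈ s, P (uA l) * (starRingEnd ℂ) (Q (uB l)) := by
  rw [TwoVectorPeriod.sum_apply_mul_conj, doublePeriod_sum_rankOne]

/-- **a non-zero spectral side has a copy with BOTH periods non-zero**. -/
theorem exists_both_ne_zero_of_ne_zero {L : Type*} (s : Finset L) (uB uA : L → V) (P Q : V →L[ℂ] ℂ)
    (h : TwoVectorPeriod.doublePeriod (∑ l ∈ s, SchurProjector.rankOne (uB l) (uA l)) P Q ≠ 0) :
    ∃ l ∈ s, P (uA l) ≠ 0 ∧ Q (uB l) ≠ 0 := by
  rw [doublePeriod_sum_rankOne] at h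
  obtain ⟨l, hl, hne⟩ := Finset.exists_ne_zero_of_sum_ne_zero h
  obtain ⟨h1, h2⟩ := mul_ne_zero_iff.1 hne
  exact ⟨l, hl, h1, fun h0 => h2 (by rw [h0, map_zero])⟩

/-- the spectral term of the copy `l`: `P (uA l) · conj (Q (uB l))`. -/
noncomputable def spec (P Q : V →L[ℂ] ℂ) {L : Type*} (uB uA : L → V) (l : L) : ℂ :=
  P (uA l) * (starRingEnd ℂ) (Q (uB l))

omit [CompleteSpace V] in
/-- the spectral term vanishes when the A-period vanishes. -/
theorem spec_zero_A (P Q : V →L[ℂ] ℂ) {L : Type*} (uB uA : L → V) (l : L) (h : P (uA l) = 0) :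
    spec P Q uB uA l = 0 := by
  unfold spec
  rw [h, zero_mul]

omit [CompleteSpace V] in
/-- the spectral term vanishes when the B-period vanishes. -/
theorem spec_zero_B (P Q : V →L[ℂ] ℂ) {L : Type*} (uB uA : L → V) (l : L) (h : Q (uB l) = 0) :
    spec P Q uB uA l = 0 := by
  unfold spec
  rw [h, map_zero, mul_zero]

/-- the spectral side is the sum of the spectral terms. -/
theorem doublePeriod_eq_sum_spec {L : Type*} (s : Finset L) (uB uA : L → V) (P Q : V →L[ℂ] ℂ) :
    TwoVectorPeriod.doublePeriod (∑ l ∈ s, SchurProjector.rankOne (uB l) (uA l)) P Q =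
      ∑ l ∈ s, spec P Q uB uA l :=
  doublePeriod_sum_rankOne s uB uA P Q

omit [CompleteSpace V] in
/-- the sum of the rank-one maps has finite rank: its range lies in the span of the `uA l`. -/
theorem range_sum_rankOne_le_span {L : Type*} (s : Finset L) (uB uA : L → V) :
    LinearMap.range ((∑ l ∈ s, SchurProjector.rankOne (uB l) (uA l) : V →L[ℂ] V) : V →ₗ[ℂ] V) ≤
      Submodule.span ℂ (Set.range uA) := by
  rintro _ ⟨x, rfl⟩
  simp only [ContinuousLinearMap.coe_coe, sum_apply, SchurProjector.rankOne_apply]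
  exact Submodule.sum_mem _ fun l _ => Submodule.smul_mem _ _ (Submodule.subset_span ⟨l, rfl⟩)

omit [CompleteSpace V] in
/-- **`R(f)` is the sum of the rank-one maps of the copies**: if the pairwise orthogonal subspaces `W l` span `V`,
`uB l ∈ W l`, and `T x = ⟪uB l, x⟫ • uA l` on `W l`, then `T = ∑ l, rankOne (uB l) (uA l)`. -/
theorem eq_sum_rankOne_of_copies {L : Type*} [Fintype L] (T : V →L[ℂ] V) (W : L → Submodule ℂ V)
    (uB uA : L → V) (huB : ∀ l, uB l ∈ W l)
    (horth : ∀ l m, l ≠ m → ∀ x ∈ W l, ∀ y ∈ W m, ⟪x, y⟫_ℂ = 0)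
    (hT : ∀ l, ∀ x ∈ W l, T x = ⟪uB l, x⟫_ℂ • uA l) (hspan : ⨆ l, W l = ⊤) :
    T = ∑ l, SchurProjector.rankOne (uB l) (uA l) := by
  have hspan' : Submodule.span ℂ (⋃ l, (W l : Set V)) = ⊤ := by
    rw [← Submodule.iSup_eq_span]
    exact hspan
  have key : ∀ x ∈ ⋃ l, (W l : Set V), T x = (∑ l, SchurProjector.rankOne (uB l) (uA l)) x := by
    intro x hxU
    obtain ⟨m, hxm⟩ := Set.mem_iUnion.1 hxU
    rw [hT m x hxm, sum_apply, Finset.sum_eq_single m]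
    · exact (SchurProjector.rankOne_apply _ _ _).symm
    · intro l _ hlm
      rw [SchurProjector.rankOne_apply, horth l m hlm (uB l) (huB l) x hxm, zero_smul]
    · intro hm
      exact absurd (Finset.mem_univ m) hm
  exact ContinuousLinearMap.coe_inj.1 (LinearMap.ext_on hspan' key)

/-- **the spectral side of `R(f)` on the copies**: under the hypotheses of `eq_sum_rankOne_of_copies`,
`doublePeriod T P Q = ∑ l, P (uA l) · conj (Q (uB l))`. -/
theorem doublePeriod_eq_sum_of_copies {L : Type*} [Fintype L] (T : V →L[ℂ] V) (W : L → Submodule ℂ V)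
    (uB uA : L → V) (huB : ∀ l, uB l ∈ W l)
    (horth : ∀ l m, l ≠ m → ∀ x ∈ W l, ∀ y ∈ W m, ⟪x, y⟫_ℂ = 0)
    (hT : ∀ l, ∀ x ∈ W l, T x = ⟪uB l, x⟫_ℂ • uA l) (hspan : ⨆ l, W l = ⊤) (P Q : V →L[ℂ] ℂ) :
    TwoVectorPeriod.doublePeriod T P Q = ∑ l, P (uA l) * (starRingEnd ℂ) (Q (uB l)) := by
  rw [eq_sum_rankOne_of_copies T W uB uA huB horth hT hspan, doublePeriod_sum_rankOne]

/-- under the same hypotheses, a non-zero double period of `T` gives a copy with both periods non-zero. -/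
theorem exists_both_ne_zero_of_copies {L : Type*} [Fintype L] (T : V →L[ℂ] V) (W : L → Submodule ℂ V)
    (uB uA : L → V) (huB : ∀ l, uB l ∈ W l)
    (horth : ∀ l m, l ≠ m → ∀ x ∈ W l, ∀ y ∈ W m, ⟪x, y⟫_ℂ = 0)
    (hT : ∀ l, ∀ x ∈ W l, T x = ⟪uB l, x⟫_ℂ • uA l) (hspan : ⨆ l, W l = ⊤) (P Q : V →L[ℂ] ℂ)
    (h : TwoVectorPeriod.doublePeriod T P Q ≠ 0) : ∃ l, P (uA l) ≠ 0 ∧ Q (uB l) ≠ 0 := by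
  rw [eq_sum_rankOne_of_copies T W uB uA huB horth hT hspan] at h
  obtain ⟨l, _, hl⟩ := exists_both_ne_zero_of_ne_zero Finset.univ uB uA P Q h
  exact ⟨l, hl⟩


omit [CompleteSpace V] in
/-- `rankOne 0 x = 0`. -/
theorem rankOne_zero_left (x : V) : SchurProjector.rankOne (0 : V) x = 0 := by
  ext v
  rw [SchurProjector.rankOne_apply, inner_zero_left, zero_smul, zero_apply]

omit [CompleteSpace V] in
/-- **the rest of the space as one more label** (crit-2 l. 15390 record (a)): finitely many pairwise orthogonal copies
`W l` whose (closed) sum `K = ⨆ l, W l` admits an orthogonal projection, `T = 0` on `Kᗮ` (every other constituent is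
killed) and `T x = ⟪uB l, x⟫ • uA l` on `W l` ⇒ `T = ∑ l, rankOne (uB l) (uA l)`. -/
theorem eq_sum_rankOne_of_copies_of_zero_orthogonal {L : Type*} [Fintype L] (T : V →L[ℂ] V)
    (W : L → Submodule ℂ V) (uB uA : L → V) (huB : ∀ l, uB l ∈ W l)
    (horth : ∀ l m, l ≠ m → ∀ x ∈ W l, ∀ y ∈ W m, ⟪x, y⟫_ℂ = 0)
    (hT : ∀ l, ∀ x ∈ W l, T x = ⟪uB l, x⟫_ℂ • uA l) [(⨆ l, W l).HasOrthogonalProjection]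
    (hT0 : ∀ x ∈ (⨆ l, W l)ᗮ, T x = 0) :
    T = ∑ l, SchurProjector.rankOne (uB l) (uA l) := by
  set K : Submodule ℂ V := ⨆ l, W l with hK
  have hWK : ∀ l, W l ≤ K := fun l => le_iSup W l
  let W' : Option L → Submodule ℂ V := fun o => o.elim Kᗮ W
  let uB' : Option L → V := fun o => o.elim 0 uB
  let uA' : Option L → V := fun o => o.elim 0 uA
  have h := eq_sum_rankOne_of_copies T W' uB' uA' ?_ ?_ ?_ ?_
  · rw [h, Fintype.sum_option]
    simp only [uB', uA', Option.elim, rankOne_zero_left, zero_add]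
  · intro o
    cases o with
    | none => exact Submodule.zero_mem _
    | some l => exact huB l
  · intro o o' hne x hx y hy
    cases o with
    | none =>
      cases o' with
      | none => exact absurd rfl hne
      | some m => exact (Submodule.mem_orthogonal' K x).1 hx y (hWK m hy)
    | some l =>
      cases o' with
      | none => exact (Submodule.mem_orthogonal K y).1 hy x (hWK l hx)
      | some m => exact horth l m (fun h => hne (by rw [h])) x hx y hy
  · intro o x hx
    cases o with
    | none =>
      show T x = ⟪(0 : V), x⟫_ℂ • (0 : V)
      rw [hT0 x hx, inner_zero_left, zero_smul]
    | some l => exact hT l x hx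
  · show ⨆ o : Option L, W' o = ⊤
    rw [iSup_option]
    show Kᗮ ⊔ ⨆ l, W l = ⊤
    rw [← hK, sup_comm]
    exact Submodule.sup_orthogonal_of_hasOrthogonalProjection

/-- the spectral side in that situation: `doublePeriod T P Q = ∑ l, P (uA l) · conj (Q (uB l))`. -/
theorem doublePeriod_eq_sum_of_copies_of_zero_orthogonal {L : Type*} [Fintype L] (T : V →L[ℂ] V)
    (W : L → Submodule ℂ V) (uB uA : L → V) (huB : ∀ l, uB l ∈ W l)
    (horth : ∀ l m, l ≠ m → ∀ x ∈ W l, ∀ y ∈ W m, ⟪x, y⟫_ℂ = 0)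
    (hT : ∀ l, ∀ x ∈ W l, T x = ⟪uB l, x⟫_ℂ • uA l) [(⨆ l, W l).HasOrthogonalProjection]
    (hT0 : ∀ x ∈ (⨆ l, W l)ᗮ, T x = 0) (P Q : V →L[ℂ] ℂ) :
    TwoVectorPeriod.doublePeriod T P Q = ∑ l, P (uA l) * (starRingEnd ℂ) (Q (uB l)) := by
  rw [eq_sum_rankOne_of_copies_of_zero_orthogonal T W uB uA huB horth hT hT0, doublePeriod_sum_rankOne]

/-- and a non-zero double period of `T` gives a copy with both periods non-zero. -/
theorem exists_both_ne_zero_of_copies_of_zero_orthogonal {L : Type*} [Fintype L] (T : V →L[ℂ] V)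
    (W : L → Submodule ℂ V) (uB uA : L → V) (huB : ∀ l, uB l ∈ W l)
    (horth : ∀ l m, l ≠ m → ∀ x ∈ W l, ∀ y ∈ W m, ⟪x, y⟫_ℂ = 0)
    (hT : ∀ l, ∀ x ∈ W l, T x = ⟪uB l, x⟫_ℂ • uA l) [(⨆ l, W l).HasOrthogonalProjection]
    (hT0 : ∀ x ∈ (⨆ l, W l)ᗮ, T x = 0) (P Q : V →L[ℂ] ℂ)
    (h : TwoVectorPeriod.doublePeriod T P Q ≠ 0) : ∃ l, P (uA l) ≠ 0 ∧ Q (uB l) ≠ 0 := by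
  rw [eq_sum_rankOne_of_copies_of_zero_orthogonal T W uB uA huB horth hT hT0] at h
  obtain ⟨l, _, hl⟩ := exists_both_ne_zero_of_ne_zero Finset.univ uB uA P Q h
  exact ⟨l, hl⟩

end Copies

end Summit.Ventures.HodgeRepro2.Tier7.Line3.TwoVectorSpectralSum
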